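import Literature.NumberTheory.CubicFields.MemUCriterion
import Mathlib.NumberTheory.LegendreSymbol.Basic
import HarnessLib

set_option linter.dupNamespace false -- `Summit.BirchSwinnertonDyer.BirchSwinnertonDyer.Theorems.…` (summit = sub, D-0017)
set_option autoImplicit false

/-!
# Crux `HeegnerTwistCouplingInSupply` (stmt-BirchSwinnertonDyer-21381) — the ROOT-LATTICE SECOND DIGIT
# of the discriminant of an integral binary cubic form (card `root-lattice-burgess-thin-dh`, cruxidea seat 1 g31)

Route `BiquadraticEisensteinDescent` (cell `pub/bsd-wall`, width seat `bsd-wall-cm-bed-w4` g27; `--supports` 21381, helper).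
The card `Ideas/root-lattice-burgess-thin-dh.md` proposes to count the `3`-divisibility of `h(ℚ(√(p·d)))` over the THIN
Heegner family `|d| ≤ p^{2−ε}` through integral binary cubic forms `f = A u³ + B u²v + C uv² + D v³` whose discriminant is
divisible by the large prime `p`, decomposing the locus `{f : p ∣ Disc f}` into the `p + 1` ROOT LATTICES
`L_a = {f : f(a) ≡ f′(a) ≡ 0 (mod p)}` (`a ∈ ℙ¹(𝔽_p)`; here `f(a) = f(a, 1)`, `f′ = ∂f/∂u`). Its lever rests on two
algebraic facts, which this file proves in the kernel in the tree's currency `Literature.NumberTheory.CubicFields.BinaryCubic`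
(integral forms, `eval`, `derivU`, `derivV`, `disc`, `subst`; files `BinaryCubicForms`, `MemUCriterion`), WITHOUT transporting
the root to `(1, 0)`:

* (i) **`p ∣ Disc f` on `L_a` is a double-root condition, LINEAR in `(C, D)` given `(A, B, a)`** — `f ∈ L_a` iff
  `C = pM − 3Aa² − 2Ba`, `D = pN + 2Aa³ + Ba²` (`mem_rootLattice_iff`), with Fourier-phase coefficient matrix of determinant
  `a⁴` (`det_phase`, `phase_injective`, `phase_bijective`);
* (ii) **the second `p`-adic digit**: on `L_a`, `p ∣ Disc f` and
  `Disc f / p ≡ −4·(3Aa + B)³·(f(a)/p) (mod p)` (`disc_eq_of_rootLattice`, `disc_div_modEq` — the card's first lemma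
  `disc_div_p_modEq`), so that the Heegner sign at `p` of `d = Disc f/p` is a product of TWO LEGENDRE SYMBOLS OF LINEAR
  FUNCTIONALS on `L_a`: `(Disc f/p | p) = (−1 | p)·(3Aa + B | p)·(f(a)/p | p)` (`legendreSym_disc_div`), and
  `p² ∣ Disc f ↔ p ∣ 3Aa + B ∨ p ∣ f(a)/p` (`sq_dvd_disc_iff`, the splitting types `(1³)` / deeper versus `(1²1)`).

The mechanism is the Taylor shift `u ↦ u + a v` — substitution by the unipotent matrix `(1 0; a 1)` of determinant `1`, under
which `Disc` is invariant and the coefficients become `(A, 3Aa + B, f′(a), f(a))` (`subst_taylor`, `disc_eq_taylor`). The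
root-at-infinity case `a = (1 : 0)` (`p ∣ A`, `p ∣ B`: `Disc/p ≡ −4(A/p)C³`) is the `ℤ`-form of the tree's `ℤ/p²ℤ` normal form
`BinaryCubic.disc_eq_of_castHom_ab` (Bhargava–Shankar–Tsimerman 2013, proof of Lemma 12; file `LocalDensityOdd`), and
`singular_map_iff` identifies `L_a (mod p)` with the tree's singular-zero condition of `f mod p` at `(a, 1)` (the three equations
of `BinaryCubic.singSet`, file `SingularZeroTransport`, where the `(p + 1)`-fold root-lattice count
`BinaryCubic.card_multipleRoot_eq_mul` of file `LocalDensityCount` already lives) — those are CITED, not redone.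

HONEST FRAMING: this is the algebraic skeleton of the card's lever (i)–(ii) only. The card's counting statements (L1) unsigned
thin-family count, (L2) Burgess–Chang for rank-`4` progressions in `𝔽_p ⊕ 𝔽_p`, (♠) the energy dichotomy, (L3)–(L4), the
residual C⁺ of crux 21381, its registered stubs and BSD are NOT touched; nothing is closed by this file.
THEOREMS ONLY (no `def`, no named fact, no sorry). Supports stmt-BirchSwinnertonDyer-21381.
[cite: BhargavaShankarTsimerman2012, proof of Lemma 12] [cite: DavenportHeilbronn1971, §4] [cite: BhargavaTaniguchiThorne2023, §2.2 (7)–(8)]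
-/

namespace Summit.BirchSwinnertonDyer.BirchSwinnertonDyer.Theorems.RootLatticeDigit

open Literature.NumberTheory.CubicFields Literature.NumberTheory.CubicFields.BinaryCubic

/-! ## §1 The Taylor shift `u ↦ u + a·v` as a unipotent substitution -/

section Taylor

variable {R : Type*} [CommRing R]

/-- **Taylor shift.** Substituting `(u, v) ↦ (u + a v, v)` (the unipotent matrix `(1 0; a 1)`) turns
`f = A u³ + B u²v + C uv² + D v³` into the form with coefficients `(A, 3Aa + B, f′(a), f(a))`, where `f(a) = f(a, 1)` and
`f′(a) = ∂f/∂u (a, 1) = 3Aa² + 2Ba + C` (Taylor expansion of `f(u + a, 1)` at `u = 0`). [folklore] -/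
theorem subst_taylor (f : BinaryCubic R) (a : R) :
    f.subst !![1, 0; a, 1] = ⟨f.a, 3 * f.a * a + f.b, f.derivU a 1, f.eval a 1⟩ := by
  ext
  · simp [BinaryCubic.subst]
  · simp [BinaryCubic.subst]
  · simp [BinaryCubic.subst, BinaryCubic.derivU]
    ring
  · simp [BinaryCubic.subst, BinaryCubic.eval]

/-- The unipotent matrix `(1 0; a 1)` has determinant `1`. [folklore] -/
theorem det_taylor (a : R) : Matrix.det !![(1 : R), 0; a, 1] = 1 := by
  simp [Matrix.det_fin_two]

/-- **`Disc` is invariant under the Taylor shift** (a determinant-`1` substitution; tree lemma `BinaryCubic.disc_subst`,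
`Disc (f ∘ γ) = (det γ)⁶ Disc f`). [cite: BhargavaTaniguchiThorne2023, §2.2 (8)] -/
theorem disc_taylor (f : BinaryCubic R) (a : R) : (f.subst !![1, 0; a, 1]).disc = f.disc := by
  rw [disc_subst, det_taylor, one_pow, one_mul]

/-- **The discriminant in Taylor coordinates at `a`**: BTT (7) evaluated on the coefficients `(A, 3Aa + B, f′(a), f(a))`.
[cite: BhargavaTaniguchiThorne2023, §2.2 (7)] -/
theorem disc_eq_taylor (f : BinaryCubic R) (a : R) :
    f.disc = (3 * f.a * a + f.b) ^ 2 * (f.derivU a 1) ^ 2 - 4 * f.a * (f.derivU a 1) ^ 3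
      - 4 * (3 * f.a * a + f.b) ^ 3 * (f.eval a 1) - 27 * f.a ^ 2 * (f.eval a 1) ^ 2
      + 18 * f.a * (3 * f.a * a + f.b) * (f.derivU a 1) * (f.eval a 1) := by
  rw [← disc_taylor f a, subst_taylor, disc_eq]

/-- **Euler's identity at `(a, 1)`** (tree `BinaryCubic.euler_identity`): `f_v(a, 1) = 3 f(a, 1) − a·f_u(a, 1)`, so the
`v`-derivative condition of a singular zero at `(a, 1)` is implied by the other two. [folklore] -/
theorem derivV_eq (f : BinaryCubic R) (a : R) :
    f.derivV a 1 = 3 * f.eval a 1 - a * f.derivU a 1 := by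
  have h := euler_identity f a 1
  linear_combination h

end Taylor

/-! ## §2 The root lattice `L_a = {f : p ∣ f(a), p ∣ f′(a)}`: linear parametrisation and the phase determinant -/

section Lattice

/-- **`L_a` is linear in `(C, D)` given `(A, B, a)`.** An integral form lies in the root lattice
`L_a = {f : p ∣ f′(a), p ∣ f(a)}` iff `C = pM − 3Aa² − 2Ba` and `D = pN + 2Aa³ + Ba²` for some integers `M, N`
(card `root-lattice-burgess-thin-dh`, lever (i): "`C ≡ −3Aa² − 2Ba`, `E ≡ 2Aa³ + Ba²`"). Holds for every integer modulus `p`.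
[folklore] -/
theorem mem_rootLattice_iff (f : BinaryCubic ℤ) (a p : ℤ) :
    (p ∣ f.derivU a 1 ∧ p ∣ f.eval a 1) ↔
      ∃ M N : ℤ, f.c = p * M - 3 * f.a * a ^ 2 - 2 * f.b * a ∧ f.d = p * N + 2 * f.a * a ^ 3 + f.b * a ^ 2 := by
  constructor
  · rintro ⟨⟨M, hM⟩, ⟨N', hN'⟩⟩
    simp only [BinaryCubic.derivU, BinaryCubic.eval] at hM hN'
    refine ⟨M, N' - a * M, by linear_combination hM, by linear_combination hN' - a * hM⟩
  · rintro ⟨M, N, hc, hd⟩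
    refine ⟨⟨M, ?_⟩, ⟨a * M + N, ?_⟩⟩
    · simp only [BinaryCubic.derivU, hc]; ring
    · simp only [BinaryCubic.eval, hc, hd]; ring

/-- In the coordinates `(A, B, M, N)` of `L_a` the two LINEAR FUNCTIONALS of the card are `ν_a = 3Aa + B` (a coefficient of
the Taylor shift) and `η_a = f(a)/p = aM + N`: indeed `f′(a) = pM` and `f(a) = p(aM + N)`. [folklore] -/
theorem eval_derivU_of_coords (f : BinaryCubic ℤ) {a p M N : ℤ}
    (hc : f.c = p * M - 3 * f.a * a ^ 2 - 2 * f.b * a) (hd : f.d = p * N + 2 * f.a * a ^ 3 + f.b * a ^ 2) :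
    f.derivU a 1 = p * M ∧ f.eval a 1 = p * (a * M + N) := by
  constructor
  · simp only [BinaryCubic.derivU, hc]; ring
  · simp only [BinaryCubic.eval, hc, hd]; ring

/-- **The Fourier-phase determinant.** The linear map `(A, B) ↦ (c_a, e_a) = (−3Aa² − 2Ba, 2Aa³ + Ba²)` (the `(A, B)`-dependence
of the congruence classes of `(C, D)` on `L_a`) has coefficient matrix `(−3a² −2a; 2a³ a²)` of determinant `a⁴` (card, lever (i):
"an INVERTIBLE `(k, l) ↦` coefficient map (det `a⁴`)"). [folklore] -/
theorem det_phase {R : Type*} [CommRing R] (a : R) :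
    Matrix.det !![-3 * a ^ 2, -2 * a; 2 * a ^ 3, a ^ 2] = a ^ 4 := by
  simp [Matrix.det_fin_two]
  ring

/-- Hence, over a field in which `a ≠ 0` (e.g. `𝔽_p` with `a ≢ 0`), **`(A, B) ↦ (−3Aa² − 2Ba, 2Aa³ + Ba²)` is injective**
(so bijective on `𝔽_p ⊕ 𝔽_p`): the cross terms of the card's box count cancel over `(A, B)`. [folklore] -/
theorem phase_injective {F : Type*} [Field F] {a : F} (ha : a ≠ 0) :
    Function.Injective (fun AB : F × F => (-3 * AB.1 * a ^ 2 - 2 * AB.2 * a, 2 * AB.1 * a ^ 3 + AB.2 * a ^ 2)) := by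
  rintro ⟨A, B⟩ ⟨A', B'⟩ h
  simp only [Prod.mk.injEq] at h ⊢
  obtain ⟨h1, h2⟩ := h
  have ha4 : a ^ 4 ≠ 0 := pow_ne_zero 4 ha
  have hA : a ^ 4 * (A - A') = 0 := by linear_combination a ^ 2 * h1 + 2 * a * h2
  have hA' : A = A' := by
    rcases mul_eq_zero.mp hA with h | h
    · exact absurd h ha4
    · exact sub_eq_zero.mp h
  refine ⟨hA', ?_⟩
  have hB : a ^ 2 * (B - B') = 0 := by rw [hA'] at h2; linear_combination h2
  rcases mul_eq_zero.mp hB with h | h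
  · exact absurd h (pow_ne_zero 2 ha)
  · exact sub_eq_zero.mp h

/-- **Bijectivity on `𝔽_p ⊕ 𝔽_p`** of the phase map for `a ≢ 0 (mod p)`. [folklore] -/
theorem phase_bijective {p : ℕ} [Fact p.Prime] {a : ZMod p} (ha : a ≠ 0) :
    Function.Bijective (fun AB : ZMod p × ZMod p => (-3 * AB.1 * a ^ 2 - 2 * AB.2 * a, 2 * AB.1 * a ^ 3 + AB.2 * a ^ 2)) :=
  (Finite.injective_iff_bijective).mp (phase_injective ha)

end Lattice

/-! ## §3 The second `p`-adic digit of `Disc` on `L_a` (the card's first lemma) -/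

section Digit

/-- **`Disc` on the root lattice, exactly.** If `f′(a) = pM` and `f(a) = pN` then
`Disc f = p·(−4(3Aa + B)³N + p·((3Aa + B)²M² − 4pAM³ − 27A²N² + 18A(3Aa + B)MN))` — for EVERY integer `p` (no primality).
[cite: BhargavaShankarTsimerman2012, proof of Lemma 12] -/
theorem disc_eq_of_rootLattice {f : BinaryCubic ℤ} {a p M N : ℤ} (hM : f.derivU a 1 = p * M) (hN : f.eval a 1 = p * N) :
    f.disc = p * (-4 * (3 * f.a * a + f.b) ^ 3 * N + p * ((3 * f.a * a + f.b) ^ 2 * M ^ 2 - 4 * p * f.a * M ^ 3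
      - 27 * f.a ^ 2 * N ^ 2 + 18 * f.a * (3 * f.a * a + f.b) * M * N)) := by
  rw [disc_eq_taylor f a, hM, hN]
  ring

/-- **`p ∣ Disc f` on `L_a`** (a double root modulo `p` forces `p ∣ Disc`; any integer `p`). [cite: DavenportHeilbronn1971, §4] -/
theorem dvd_disc_of_rootLattice {f : BinaryCubic ℤ} {a p : ℤ} (hM : p ∣ f.derivU a 1) (hN : p ∣ f.eval a 1) :
    p ∣ f.disc := by
  obtain ⟨M, hM⟩ := hM
  obtain ⟨N, hN⟩ := hN
  exact ⟨_, disc_eq_of_rootLattice hM hN⟩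

/-- **The quotient `Disc f / p` on `L_a`**: `Disc f / p = −4(3Aa + B)³N + p·(…)` (`p ≠ 0`). [cite: BhargavaShankarTsimerman2012, proof of Lemma 12] -/
theorem disc_div_eq_of_rootLattice {f : BinaryCubic ℤ} {a p M N : ℤ} (hp : p ≠ 0) (hM : f.derivU a 1 = p * M)
    (hN : f.eval a 1 = p * N) :
    f.disc / p = -4 * (3 * f.a * a + f.b) ^ 3 * N + p * ((3 * f.a * a + f.b) ^ 2 * M ^ 2 - 4 * p * f.a * M ^ 3
      - 27 * f.a ^ 2 * N ^ 2 + 18 * f.a * (3 * f.a * a + f.b) * M * N) := by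
  rw [disc_eq_of_rootLattice hM hN, Int.mul_ediv_cancel_left _ hp]

/-- ★ **The card's first lemma (`disc_div_p_modEq`), second `p`-adic digit of `Disc` on the root lattice `L_a`.**
If `p ∣ f′(a)` and `f(a) = pN` then `Disc f / p ≡ −4·(3Aa + B)³·N (mod p)` (card `root-lattice-burgess-thin-dh`, First lemma:
"`Disc f/p ≡ −4·(f″(a)/2)³·(f(a)/p) (mod p)`", with `f″(a)/2 = 3Aa + B`). Any integer `p ≠ 0`.
[cite: BhargavaShankarTsimerman2012, proof of Lemma 12] -/
theorem disc_div_modEq {f : BinaryCubic ℤ} {a p N : ℤ} (hp : p ≠ 0) (hM : p ∣ f.derivU a 1) (hN : f.eval a 1 = p * N) :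
    f.disc / p ≡ -4 * (3 * f.a * a + f.b) ^ 3 * N [ZMOD p] := by
  obtain ⟨M, hM⟩ := hM
  rw [disc_div_eq_of_rootLattice hp hM hN]
  exact Int.modEq_iff_dvd.2 ⟨-((3 * f.a * a + f.b) ^ 2 * M ^ 2 - 4 * p * f.a * M ^ 3
      - 27 * f.a ^ 2 * N ^ 2 + 18 * f.a * (3 * f.a * a + f.b) * M * N), by ring⟩

/-- The same with `N = f(a)/p` spelled as a quotient. [cite: BhargavaShankarTsimerman2012, proof of Lemma 12] -/
theorem disc_div_modEq' {f : BinaryCubic ℤ} {a p : ℤ} (hp : p ≠ 0) (hM : p ∣ f.derivU a 1) (hN : p ∣ f.eval a 1) :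
    f.disc / p ≡ -4 * (3 * f.a * a + f.b) ^ 3 * (f.eval a 1 / p) [ZMOD p] := by
  obtain ⟨N, hN⟩ := hN
  rw [hN, Int.mul_ediv_cancel_left _ hp]
  exact disc_div_modEq hp hM hN

/-- **`(1²1)` versus `(1³)`-or-deeper on `L_a`**: for a prime `p ≠ 2` with `p ∣ f′(a)`, `f(a) = pN`:
`p² ∣ Disc f ↔ p ∣ 3Aa + B ∨ p ∣ N`. [cite: BhargavaShankarTsimerman2012, proof of Lemma 12] -/
theorem sq_dvd_disc_iff {f : BinaryCubic ℤ} {a N : ℤ} {p : ℕ} (hp : p.Prime) (hp2 : p ≠ 2)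
    (hM : (p : ℤ) ∣ f.derivU a 1) (hN : f.eval a 1 = p * N) :
    (p : ℤ) ^ 2 ∣ f.disc ↔ (p : ℤ) ∣ 3 * f.a * a + f.b ∨ (p : ℤ) ∣ N := by
  have hp0 : (p : ℤ) ≠ 0 := by exact_mod_cast hp.ne_zero
  have hpI : Prime (p : ℤ) := Nat.prime_iff_prime_int.mp hp
  obtain ⟨M, hM⟩ := hM
  have key := disc_eq_of_rootLattice hM hN
  set b := 3 * f.a * a + f.b with hb
  set E := b ^ 2 * M ^ 2 - 4 * p * f.a * M ^ 3 - 27 * f.a ^ 2 * N ^ 2 + 18 * f.a * b * M * N with hE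
  -- `p² ∣ Disc ↔ p ∣ −4 b³ N`
  have h1 : (p : ℤ) ^ 2 ∣ f.disc ↔ (p : ℤ) ∣ -4 * b ^ 3 * N := by
    rw [key, sq]
    constructor
    · intro h
      have h' : (p : ℤ) ∣ -4 * b ^ 3 * N + p * E := (mul_dvd_mul_iff_left hp0).mp h
      have : -4 * b ^ 3 * N = (-4 * b ^ 3 * N + p * E) - p * E := by ring
      rw [this]
      exact dvd_sub h' (dvd_mul_right _ _)
    · intro h
      exact mul_dvd_mul_left _ (dvd_add h (dvd_mul_right _ _))
  rw [h1]
  -- `p ∤ 4` for `p ≠ 2`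
  have h4 : ¬ (p : ℤ) ∣ -4 := by
    rw [dvd_neg]
    intro h
    have h' : p ∣ 4 := by exact_mod_cast h
    have : p ∣ 2 := hp.dvd_of_dvd_pow (show p ∣ 2 ^ 2 by simpa using h')
    exact hp2 ((Nat.prime_dvd_prime_iff_eq hp Nat.prime_two).mp this)
  constructor
  · intro h
    rcases hpI.dvd_or_dvd h with h' | h'
    · rcases hpI.dvd_or_dvd h' with h'' | h''
      · exact absurd h'' h4
      · exact Or.inl (hpI.dvd_of_dvd_pow h'')
    · exact Or.inr h'
  · rintro (h | h)
    · exact dvd_mul_of_dvd_left (dvd_mul_of_dvd_right (dvd_pow h three_ne_zero) _) _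
    · exact dvd_mul_of_dvd_right h _

end Digit

/-! ## §4 The Heegner sign at `p` on `L_a`: a product of two Legendre symbols of linear functionals -/

section Sign

variable {p : ℕ} [Fact p.Prime]

/-- `(b³ | p) = (b | p)` for every integer `b` (both sides vanish when `p ∣ b`). [folklore] -/
theorem legendreSym_pow_three (b : ℤ) : legendreSym p (b ^ 3) = legendreSym p b := by
  rw [show b ^ 3 = b ^ 2 * b by ring, legendreSym.mul]
  by_cases hb : (b : ZMod p) = 0
  · rw [(legendreSym.eq_zero_iff p b).mpr hb, mul_zero]
  · rw [legendreSym.sq_one' p hb, one_mul]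

/-- `(−4 | p) = (−1 | p)` for an odd prime `p`. [folklore] -/
theorem legendreSym_neg_four (hp2 : p ≠ 2) : legendreSym p (-4) = legendreSym p (-1) := by
  have h2 : ((2 : ℤ) : ZMod p) ≠ 0 := by
    rw [Ne, ZMod.intCast_zmod_eq_zero_iff_dvd]
    intro h
    have h' : p ∣ 2 := by exact_mod_cast h
    exact hp2 ((Nat.prime_dvd_prime_iff_eq (Fact.out) Nat.prime_two).mp h')
  rw [show (-4 : ℤ) = -1 * 2 ^ 2 by norm_num, legendreSym.mul, legendreSym.sq_one' p h2, mul_one]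

/-- Congruent integers have the same Legendre symbol. [folklore] -/
theorem legendreSym_congr {x y : ℤ} (h : x ≡ y [ZMOD p]) : legendreSym p x = legendreSym p y := by
  rw [legendreSym.mod p x, legendreSym.mod p y]
  exact congrArg _ h

/-- ★ **The Heegner sign is a product of two Legendre symbols of LINEAR functionals on `L_a`.** For an odd prime `p`,
`p ∣ f′(a)` and `f(a) = pN`: `(Disc f/p | p) = (−1 | p)·(3Aa + B | p)·(N | p)` (card `root-lattice-burgess-thin-dh`, lever (ii):
"`χ_p(−1)·χ_p(f″(ã)/2)·χ_p(f(ã)/p)` — two linear functionals `η_a, ν_a : L_a → 𝔽_p`"; when `p` divides `3Aa + B` or `N`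
both sides are `0`, cf. `sq_dvd_disc_iff`). [cite: BhargavaShankarTsimerman2012, proof of Lemma 12] -/
theorem legendreSym_disc_div {f : BinaryCubic ℤ} {a N : ℤ} (hp2 : p ≠ 2) (hM : (p : ℤ) ∣ f.derivU a 1)
    (hN : f.eval a 1 = p * N) :
    legendreSym p (f.disc / p) = legendreSym p (-1) * legendreSym p (3 * f.a * a + f.b) * legendreSym p N := by
  have hp0 : (p : ℤ) ≠ 0 := by exact_mod_cast (Fact.out : p.Prime).ne_zero
  rw [legendreSym_congr (disc_div_modEq hp0 hM hN), legendreSym.mul, legendreSym.mul, legendreSym_neg_four hp2,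
    legendreSym_pow_three]

/-- The same with `N = f(a)/p` spelled as a quotient. [cite: BhargavaShankarTsimerman2012, proof of Lemma 12] -/
theorem legendreSym_disc_div' {f : BinaryCubic ℤ} {a : ℤ} (hp2 : p ≠ 2) (hM : (p : ℤ) ∣ f.derivU a 1)
    (hN : (p : ℤ) ∣ f.eval a 1) :
    legendreSym p (f.disc / p) =
      legendreSym p (-1) * legendreSym p (3 * f.a * a + f.b) * legendreSym p (f.eval a 1 / p) := by
  have hp0 : (p : ℤ) ≠ 0 := by exact_mod_cast (Fact.out : p.Prime).ne_zero
  obtain ⟨N, hN⟩ := hN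
  rw [hN, Int.mul_ediv_cancel_left _ hp0]
  exact legendreSym_disc_div hp2 hM hN

/-- **In coordinates**: for `f ∈ L_a` written as `C = pM − 3Aa² − 2Ba`, `D = pN + 2Aa³ + Ba²` (so `f(a)/p = aM + N`),
`(Disc f/p | p) = (−1 | p)·(3Aa + B | p)·(aM + N | p)`. [cite: BhargavaShankarTsimerman2012, proof of Lemma 12] -/
theorem legendreSym_disc_div_of_coords (f : BinaryCubic ℤ) {a M N : ℤ} (hp2 : p ≠ 2)
    (hc : f.c = p * M - 3 * f.a * a ^ 2 - 2 * f.b * a) (hd : f.d = p * N + 2 * f.a * a ^ 3 + f.b * a ^ 2) :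
    legendreSym p (f.disc / p) =
      legendreSym p (-1) * legendreSym p (3 * f.a * a + f.b) * legendreSym p (a * M + N) := by
  obtain ⟨hM, hN⟩ := eval_derivU_of_coords f hc hd
  exact legendreSym_disc_div hp2 ⟨M, hM⟩ hN

end Sign

/-! ## §5 The root at infinity `(1 : 0)`: `p ∣ A`, `p ∣ B` (the `ℤ`-form of the tree's `ℤ/p²ℤ` normal form) -/

section Infinity

/-- **`Disc` on `L_∞`, exactly**: if `A = pA₁`, `B = pB₁` then
`Disc f = p·(−4A₁C³ + p·(B₁²C² − 4pB₁³D − 27A₁²D² + 18A₁B₁CD))` (any integer `p`; over `ℤ/p²ℤ` this is the tree's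
`BinaryCubic.disc_eq_of_castHom_ab`, "`Disc ≡ −4ac³`"). [cite: BhargavaShankarTsimerman2012, proof of Lemma 12] -/
theorem disc_eq_of_dvd_a_b {f : BinaryCubic ℤ} {p A₁ B₁ : ℤ} (ha : f.a = p * A₁) (hb : f.b = p * B₁) :
    f.disc = p * (-4 * A₁ * f.c ^ 3 + p * (B₁ ^ 2 * f.c ^ 2 - 4 * p * B₁ ^ 3 * f.d - 27 * A₁ ^ 2 * f.d ^ 2
      + 18 * A₁ * B₁ * f.c * f.d)) := by
  rw [disc_eq, ha, hb]
  ring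

/-- **Second digit at infinity**: `p ∣ A`, `p ∣ B`, `A = pA₁` ⇒ `Disc f / p ≡ −4A₁C³ (mod p)` (`p ≠ 0`).
[cite: BhargavaShankarTsimerman2012, proof of Lemma 12] -/
theorem disc_div_modEq_of_dvd_a_b {f : BinaryCubic ℤ} {p A₁ : ℤ} (hp : p ≠ 0) (ha : f.a = p * A₁) (hb : p ∣ f.b) :
    f.disc / p ≡ -4 * A₁ * f.c ^ 3 [ZMOD p] := by
  obtain ⟨B₁, hb⟩ := hb
  rw [disc_eq_of_dvd_a_b ha hb, Int.mul_ediv_cancel_left _ hp]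
  exact Int.modEq_iff_dvd.2
    ⟨-(B₁ ^ 2 * f.c ^ 2 - 4 * p * B₁ ^ 3 * f.d - 27 * A₁ ^ 2 * f.d ^ 2 + 18 * A₁ * B₁ * f.c * f.d), by ring⟩

/-- **Heegner sign at infinity**: for an odd prime `p` with `A = pA₁`, `p ∣ B`:
`(Disc f/p | p) = (−1 | p)·(A₁ | p)·(C | p)` — again two linear functionals (`A/p` and `C`) on `L_∞`.
[cite: BhargavaShankarTsimerman2012, proof of Lemma 12] -/
theorem legendreSym_disc_div_of_dvd_a_b {p : ℕ} [Fact p.Prime] {f : BinaryCubic ℤ} {A₁ : ℤ} (hp2 : p ≠ 2)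
    (ha : f.a = p * A₁) (hb : (p : ℤ) ∣ f.b) :
    legendreSym p (f.disc / p) = legendreSym p (-1) * legendreSym p A₁ * legendreSym p f.c := by
  have hp0 : (p : ℤ) ≠ 0 := by exact_mod_cast (Fact.out : p.Prime).ne_zero
  rw [legendreSym_congr (disc_div_modEq_of_dvd_a_b hp0 ha hb), show -4 * A₁ * f.c ^ 3 = -4 * A₁ * (f.c ^ 3) by ring,
    legendreSym.mul, legendreSym.mul, legendreSym_neg_four hp2, legendreSym_pow_three]

end Infinity

/-! ## §6 Bridge: `L_a (mod p)` is the singular-zero condition of `f mod p` at `(a, 1)` -/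

section Bridge

/-- `derivU` commutes with change of ring (companion of the tree's `BinaryCubic.eval_map`). [folklore] -/
theorem derivU_map {R S : Type*} [CommRing R] [CommRing S] (φ : R →+* S) (f : BinaryCubic R) (u v : R) :
    (f.map φ).derivU (φ u) (φ v) = φ (f.derivU u v) := by
  simp only [BinaryCubic.derivU, BinaryCubic.map_a, BinaryCubic.map_b, BinaryCubic.map_c, map_add, map_mul, map_pow,
    map_ofNat]

/-- `derivV` commutes with change of ring. [folklore] -/
theorem derivV_map {R S : Type*} [CommRing R] [CommRing S] (φ : R →+* S) (f : BinaryCubic R) (u v : R) :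
    (f.map φ).derivV (φ u) (φ v) = φ (f.derivV u v) := by
  simp only [BinaryCubic.derivV, BinaryCubic.map_b, BinaryCubic.map_c, BinaryCubic.map_d, map_add, map_mul, map_pow,
    map_ofNat]

/-- ★ **`L_a` modulo `p` = singular zero of `f mod p` at `(a, 1)`.** For any `p`, the three equations
`f̄(ā, 1) = f̄_u(ā, 1) = f̄_v(ā, 1) = 0` of the reduction `f̄ = f mod p` — by `BinaryCubic.mem_singSet` literally the statement
`(ā, 1) ∈ f̄.singSet` of file `SingularZeroTransport` — hold iff `p ∣ f(a)` and `p ∣ f′(a)` (the `v`-derivative condition is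
automatic by Euler's identity `3f = u f_u + v f_v`). So the card's `p + 1` root lattices are exactly the fibres of the tree's
multiple-root locus over `ℙ¹(𝔽_p)` (`BinaryCubic.card_multipleRoot_eq_mul`, file `LocalDensityCount`).
[cite: BhargavaShankarTsimerman2012, proof of Lemma 12 (the unique multiple root of f in ℙ¹(𝔽_p))] -/
theorem singular_map_iff (f : BinaryCubic ℤ) (a : ℤ) (p : ℕ) :
    ((f.map (Int.castRingHom (ZMod p))).eval (a : ZMod p) 1 = 0 ∧
        (f.map (Int.castRingHom (ZMod p))).derivU (a : ZMod p) 1 = 0 ∧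
        (f.map (Int.castRingHom (ZMod p))).derivV (a : ZMod p) 1 = 0) ↔
      ((p : ℤ) ∣ f.eval a 1 ∧ (p : ℤ) ∣ f.derivU a 1) := by
  have he : (f.map (Int.castRingHom (ZMod p))).eval (a : ZMod p) 1 = ((f.eval a 1 : ℤ) : ZMod p) := by
    simpa using eval_map (Int.castRingHom (ZMod p)) f a 1
  have hu : (f.map (Int.castRingHom (ZMod p))).derivU (a : ZMod p) 1 = ((f.derivU a 1 : ℤ) : ZMod p) := by
    simpa using derivU_map (Int.castRingHom (ZMod p)) f a 1
  have hv : (f.map (Int.castRingHom (ZMod p))).derivV (a : ZMod p) 1 = ((f.derivV a 1 : ℤ) : ZMod p) := by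
    simpa using derivV_map (Int.castRingHom (ZMod p)) f a 1
  rw [he, hu, hv, ZMod.intCast_zmod_eq_zero_iff_dvd, ZMod.intCast_zmod_eq_zero_iff_dvd,
    ZMod.intCast_zmod_eq_zero_iff_dvd]
  constructor
  · rintro ⟨h1, h2, -⟩
    exact ⟨h1, h2⟩
  · rintro ⟨h1, h2⟩
    refine ⟨h1, h2, ?_⟩
    rw [derivV_eq]
    exact dvd_sub (dvd_mul_of_dvd_right h1 _) (dvd_mul_of_dvd_right h2 _)

/-- Consequently the reduction of `Disc f` modulo `p` vanishes on `L_a` (for `f̄ ≠ 0` this is the splitting type `(1²1)` or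
`(1³)` of Davenport–Heilbronn). [cite: DavenportHeilbronn1971, §4] -/
theorem disc_map_eq_zero_of_rootLattice (f : BinaryCubic ℤ) {a : ℤ} {p : ℕ} (hN : (p : ℤ) ∣ f.eval a 1)
    (hM : (p : ℤ) ∣ f.derivU a 1) : (f.map (Int.castRingHom (ZMod p))).disc = 0 := by
  rw [disc_map, eq_intCast, ZMod.intCast_zmod_eq_zero_iff_dvd]
  exact dvd_disc_of_rootLattice hM hN

end Bridge

end Summit.BirchSwinnertonDyer.BirchSwinnertonDyer.Theorems.RootLatticeDigit
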